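import Literature.NumberTheory.Transcendental.BakerRelationDecomposition
import Literature.NumberTheory.Transcendental.SemialgebraicAlgebraicPoints
import Literature.NumberTheory.Transcendental.KZSemialgebraicComplex
import Literature.NumberTheory.Transcendental.KZCalculusOver
import Literature.NumberTheory.Transcendental.KZIntervalPeriodProofs
import Literature.NumberTheory.Transcendental.KZLogCalculusProofs
import Literature.NumberTheory.Transcendental.KZDominatedFamilyRelations
import Literature.ModelTheory.ExponentialFields.SemialgebraicInterior
import Literature.ModelTheory.ExponentialFields.CylindricalDecompositionProofs
import Literature.NumberTheory.Transcendental.SemialgebraicLineDeriv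
import Literature.NumberTheory.Transcendental.KZTorusLogRep
import Summits.KontsevichZagierPeriods.KontsevichZagierPeriods.Theorems.LiouvilleUnfoldingLogPrimitiveNLStubDescent
import Summits.KontsevichZagierPeriods.KontsevichZagierPeriods.Theorems.LiouvilleUnfoldingLogPrimitiveNLStubPeelingStep
import Summits.KontsevichZagierPeriods.KontsevichZagierPeriods.Theorems.LiouvilleUnfoldingLogPrimitiveNLStubConstRigidity
import Mathlib.FieldTheory.AlgebraicClosure
import Mathlib.RingTheory.AlgebraicIndependent.Transcendental
import Mathlib.Topology.MetricSpace.Pseudo.Pi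
import Mathlib.Analysis.SpecialFunctions.Log.Deriv
import Mathlib.Analysis.SpecialFunctions.Trigonometric.ArctanDeriv
import Mathlib.Algebra.BigOperators.Fin
import Summits.KontsevichZagierPeriods.KontsevichZagierPeriods.Theorems.RootDecompRelativeModAbsoluteCylLogSplitP52

/-! # `RootDecompRelativeModAbsoluteCircleLogP1` — part 1/11 of the mechanical ≤400-line split of `CircleLogTranscendence_landing.lean` (sha256 022159109aaffa3a…)
Source: decomp-kz lens-3 g13 `CircleLogTranscendence_v9.lean` (HOME/decomp-kz-lens-3/g13/, sha256 afb45a43…; critic g5-45/60/65/68/69 CLEARED FOR LANDING --supports 30572 (§4 defs, §8–§10 CircleLogStructureAt 0 from the tree's baker_decomposition_complex, constant-data cells every n, §16–§23 descent ingredients); landed by census-1 g9 over the landed CylLogSplitP52 (BLOCK G13): the duplicate def CircleLogStructure is dropped in favour of the landed one).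
Split by census-1 g9 `gen/splitlean.py`: scopes re-opened with their `open`/`variable`/`set_option` context; mathematics and declaration order unchanged. -/

/-!
# Route RootDecompRelativeModAbsolute · rung 30571/30572 · circle leaf — the TRANSCENDENCE SIDE of `CircleLogStructure`
(decomp-kz lens-3 g13; standalone, landable part, v9: = `CircleSplit.lean` §4 (the structure / rigidity `def`s) + §8 + §9 + §10 + §12 + §14 + §15 + §16 + §17 + §18 + §19 + §20 + §21 + §22 + §23, nothing else)

`CircleLogStructure` is the joint log/arctangent STRUCTURE statement feeding the circle node
`CylKernelZeroCirclePos ⟸ CircleLogStructureAt 1 ∧ CircleBoundaryRigidity ∧ CellCloseCSWild` (CircleSplit.lean §11).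
This file PROVES, from the tree's Baker theorem (`baker_decomposition_complex`) and real-algebraic geometry over `ℚ`:
* §8 `circleLogStructureAt_zero : CircleLogStructureAt 0`;
* §9 `circleLogStructure_constData` — the conclusion on CONSTANT-DATA cells in EVERY base dimension — and
  `circleLog_rhs_eq_zero` — the inhomogeneous part `g` vanishes for ALL data;
* §10 `circleLogStructureAt_one_of_moving : CircleLogStructureMoving → CircleLogStructureAt 1` — at base dimension 1 the
  statement REDUCES to its MOVING-DATA case on open interval cells (`CircleLogStructureMoving`, the residual; functional
  Ax–Schanuel type);
* §12 `logStructure` (the tree's LOG-linear structure theorem, line `logderiv-peeling`, composed BY NAME),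
  `circleLogStructureAt_of_p_eq_zero` (every `n`), and the sharper reduction
  `circleLogStructureAt_one_of_movingCirc : CircleLogStructureMovingCirc → CircleLogStructureAt 1` — the residual needs a GENUINE
  arctangent term and a moving datum;
* §14 `CircleBoundaryRigidityAt`, the transcendence-free `CircleCellwiseFoldAt` and
  `circleBoundaryRigidityAt_of_CLS_fold : CircleLogStructureAt n → CircleCellwiseFoldAt n → CircleBoundaryRigidityAt n`;
* §15 the fold split `LogCellwiseFoldAt` (VERBATIM the tree's `stub_cellwiseFold stub_coneDecomposition n`) + `AngleCellwiseFoldAt`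
  (angle addition in families) and `circleCellwiseFoldAt_of_log_angle`;
* §16 `circleConstRigidity` — constant algebraic coefficients, MOVING data: `G ≡ 0`, exact multiplicative AND exact angle relations
  (mixed pointwise Baker at rational points, `mixedBaker_point`), the bottom of the descent planned for `CircleLogStructureMovingCirc`;
* §17 `circleLogStructure_constCoeff` — the structure conclusion for constant COEFFICIENTS and moving data, every `n` (one cell, exact relations);
* §18 `circleLogStructure_projConstCoeff` — the same for coefficients `φ·(constant vector)`, `φ` a nowhere-zero `ℚ`-sa function (descent case (a));
* §19 `circleLogStructure_of_cells` — localisation of the structure conclusion along a.e. open sa partitions (descent bookkeeping, every `n`);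
* §20 `circle_identity_fderiv` — the differentiated identity `Σ ∂h·log W + Σ ∂p·arctan u = ∂g − Σ h ∂W/W − Σ p ∂u/(1+u²)` (descent step 3, every `n`);
* §21 `circle_identity_elimLog` / `circleLogStructure_elimLog` / `circle_identity_elimAngle` / `circleLogStructure_elimAngle` — elimination of one
  term by an exact relation and translation of the structure data back (descent step 4(b), every `n`);
* §22 `circle_identity_dropLog` / `circleLogStructure_dropLog` / `circle_identity_dropAngle` / `circleLogStructure_dropAngle` — dropping a term whose
  coefficient vanishes identically (reindex by `Fin.succAbove`; relations extended by `0`), so the term count drops after §21;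
* §23 `CircleStructExactOn` (abbrev: the EXACT structure predicate = the descent invariant) with `circleLogStructure_of_exact` and the exact twins
  `circleStructExact_constCoeff` / `_projConstCoeff` / `_of_cells` / `_elimLog` / `_elimAngle` / `_dropLog` / `_dropAngle`.
All theorems: 0 sorry, axioms [propext, Classical.choice, Quot.sound].  LANDING: one part (< 200 kB); when the CircleSplit
§0–§7/§11 parts land, they import this part and drop their §4 copies of `CircleLogStructure` / `CircleLogStructureAt`.
§9a is a VERBATIM COPY of PROVED item 4090 (`Theorems/DefinableMovesAlgebraicPoints.lean`, unbuilt on the farm at writing) — drop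
it for an import once that module builds.
-/

noncomputable section
open Set MeasureTheory Filter Topology
open scoped BigOperators
open Literature.NumberTheory.Transcendental Literature.ModelTheory.ExponentialFields

namespace Summit.KontsevichZagierPeriods.RootDecompRelativeModAbsolute.Rung30571.RegularisedLogLayer.CylLog.Leaf

namespace G13

/-- `CircleLogStructure` at ONE base dimension `n` (`CircleLogStructure ↔ ∀ n, CircleLogStructureAt n` is `Iff.rfl`). -/
def CircleLogStructureAt (n : ℕ) : Prop :=
  ∀ (k l : ℕ) (U : Set (Fin n → ℝ)) (h W : Fin k → (Fin n → ℝ) → ℝ) (p u : Fin l → (Fin n → ℝ) → ℝ)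
    (g : (Fin n → ℝ) → ℝ),
    IsSemialgebraic ℚ U → (∀ i, IsSemialgebraicFunOn ℚ U (h i)) →
    (∀ i, IsSemialgebraicFunOn ℚ U (W i)) → (∀ i, ∀ x ∈ U, 0 < W i x) →
    (∀ j, IsSemialgebraicFunOn ℚ U (p j)) → (∀ j, IsSemialgebraicFunOn ℚ U (u j)) →
    IsSemialgebraicFunOn ℚ U g →
    (∀ x ∈ U, ∑ i, h i x * Real.log (W i x) + ∑ j, p j x * Real.arctan (u j x) = g x) →
    ∃ (N : ℕ) (C : Fin N → Set (Fin n → ℝ)),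
      (∀ c, IsSemialgebraic ℚ (C c) ∧ IsOpen (C c) ∧ C c ⊆ U) ∧
      Pairwise (Function.onFun Disjoint C) ∧ volume (U \ ⋃ c, C c) = 0 ∧
      ∀ c, (∀ x ∈ C c, g x = 0) ∧
        ∃ (R : ℕ) (f : Fin R → Fin k → ℤ) (q : Fin R → (Fin n → ℝ) → ℝ)
          (S : ℕ) (f' : Fin S → Fin l → ℤ) (m : Fin S → ℚ) (q' : Fin S → (Fin n → ℝ) → ℝ),
          (∀ r, IsSemialgebraicFunOn ℚ (C c) (q r)) ∧ (∀ r, ∀ x ∈ C c, ∏ i, W i x ^ (f r i) = 1) ∧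
          (∀ i, ∀ x ∈ C c, h i x = ∑ r, q r x * (f r i : ℝ)) ∧
          (∀ s, IsSemialgebraicFunOn ℚ (C c) (q' s)) ∧
          (∀ s, ∀ x ∈ C c, ∑ j, (f' s j : ℝ) * Real.arctan (u j x) = (m s : ℝ) * Real.pi) ∧
          (∀ x ∈ C c, ∑ s, q' s x * (m s : ℝ) = 0) ∧
          (∀ j, ∀ x ∈ C c, p j x = ∑ s, q' s x * (f' s j : ℝ))

/-- Auxiliary step `circleLogStructure_iff_forall_at`: circle Log Structure iff forall at. [bookkeeping] -/
theorem circleLogStructure_iff_forall_at : CircleLogStructure ↔ ∀ n, CircleLogStructureAt n := Iff.rfl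

/-- `CircleBoundaryRigidity` at ONE base dimension `n` (`CircleBoundaryRigidity ↔ ∀ n, CircleBoundaryRigidityAt n` is `Iff.rfl`); the chain
below consumes it at `n = 1` only (§14 splits it further into structure + fold). -/
def CircleBoundaryRigidityAt (n : ℕ) : Prop :=
  ∀ (k l : ℕ) (g : KZ.IntegralRep n) (h W : Fin k → (Fin n → ℝ) → ℝ) (p u : Fin l → (Fin n → ℝ) → ℝ)
    (U : Fin k → KZ.IntegralRep (n + 1)) (A : Fin l → KZ.IntegralRep (n + 1)),
    (∀ i, IsSemialgebraicFunOn ℚ g.domain (h i)) → (∀ i, IsSemialgebraicFunOn ℚ g.domain (W i)) →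
    (∀ j, IsSemialgebraicFunOn ℚ g.domain (p j)) → (∀ j, IsSemialgebraicFunOn ℚ g.domain (u j)) →
    (∀ i, ∀ x ∈ g.domain, 1 ≤ W i x) → (∀ j, ∀ x ∈ g.domain, 0 ≤ u j x) →
    (∀ i, (U i).domain = {z | (Fin.init z : Fin n → ℝ) ∈ g.domain ∧ 1 ≤ z (Fin.last n) ∧
      z (Fin.last n) ≤ W i (Fin.init z)}) →
    (∀ i, EqOn (U i).integrand (fun z => h i (Fin.init z) / z (Fin.last n)) (U i).domain) →
    (∀ j, (A j).domain = {z | (Fin.init z : Fin n → ℝ) ∈ g.domain ∧ 0 ≤ z (Fin.last n) ∧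
      z (Fin.last n) ≤ u j (Fin.init z)}) →
    (∀ j, EqOn (A j).integrand (fun z => p j (Fin.init z) / (1 + z (Fin.last n) ^ 2)) (A j).domain) →
    (∀ i, IntegrableOn (fun x => h i x * Real.log (W i x)) g.domain) →
    (∀ j, IntegrableOn (fun x => p j x * Real.arctan (u j x)) g.domain) →
    (∀ x ∈ g.domain, g.integrand x = ∑ i, h i x * Real.log (W i x) + ∑ j, p j x * Real.arctan (u j x)) →
    ∑ i, KZ.of (U i) + ∑ j, KZ.of (A j) - KZ.of g ∈ KZ.relations

/-- Auxiliary step `circleBoundaryRigidity_iff_forall_at`: circle Boundary Rigidity iff forall at. [bookkeeping] -/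
theorem circleBoundaryRigidity_iff_forall_at : CircleBoundaryRigidity ↔ ∀ n, CircleBoundaryRigidityAt n := Iff.rfl

/-! ### §8 THE `n = 0` STRATUM OF `CircleLogStructure` — PROVED FROM THE TREE'S BAKER THEOREM

`Literature.NumberTheory.Transcendental.baker_decomposition_complex` (Baker 1975, Thm 2.1 — PROVED in the tree, standard axioms):
a vanishing linear form `r + Σ γ_t ℓ_t = 0` in logarithms `ℓ_t` of algebraic numbers with algebraic coefficients has `r = 0` and
`γ` an algebraic combination of RATIONAL exact relations among the `ℓ_t`.  At base dimension `n = 0` all data of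
`CircleLogStructure` are real algebraic NUMBERS (`IsSemialgebraicFunOn.isAlgebraic_apply`); with
`ℓ = (log Wᵢ)ᵢ ⊕ (2i·arctan uⱼ)ⱼ` (`exp ℓ` algebraic: `Wᵢ`, resp. `((1−uⱼ²) + 2uⱼ·i)/(1+uⱼ²)`) and
`γ = (hᵢ)ᵢ ⊕ (−pⱼ/2 · i)ⱼ` the identity `Σ hᵢ log Wᵢ + Σ pⱼ arctan uⱼ = g` is `−g + Σ γ_t ℓ_t = 0`; Baker gives `g = 0`; the REAL
parts of the rational relations are exact multiplicative relations `∏ Wᵢ^{fᵢ} = 1`, the IMAGINARY parts exact angle relations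
`Σ f′ⱼ arctan uⱼ = 0` (so `m ≡ 0`), and the coefficient identities are their real / imaginary parts (`q_ρ = h_{ι(ρ)}/D_ρ`,
`q′_ρ = p_{ι(ρ)}/D_ρ`, `D_ρ` = common denominator).  The critic's «Baker COSTUME(cite)» for the constant stratum is thus a THEOREM here;
the same computation, made uniform in `x` (the relation vectors depend only on the VALUES `Wᵢ(x), uⱼ(x)`), is the constant-data-cell
case of `CircleLogStructureAt 1`, and the `n ≥ 1` moving-data case is the complex twin of the tree's Ax–Schanuel germ engine. -/

/-- `i` is algebraic. -/
private theorem isAlgebraic_I : IsAlgebraic ℚ Complex.I := by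
  refine ⟨Polynomial.X ^ 2 + Polynomial.C 1, (Polynomial.monic_X_pow_add_C (1:ℚ) two_ne_zero).ne_zero, ?_⟩
  simp [Complex.I_sq]

/-- Real algebraic numbers are algebraic in `ℂ`. -/
private theorem isAlgebraic_ofReal {x : ℝ} (hx : IsAlgebraic ℚ x) : IsAlgebraic ℚ (x : ℂ) := by
  simpa using hx.algebraMap (A := ℂ)

/-- `exp(2i·arctan v) = ((1−v²) + 2v·i)/(1+v²)` is algebraic for algebraic `v`. -/
theorem isAlgebraic_exp_two_arctan_mul_I {v : ℝ} (hv : IsAlgebraic ℚ v) :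
    IsAlgebraic ℚ (Complex.exp (((2 * Real.arctan v : ℝ) : ℂ) * Complex.I)) := by
  have hv2 : 0 < 1 + v ^ 2 := by positivity
  have hs : Real.sqrt (1 + v ^ 2) ^ 2 = 1 + v ^ 2 := Real.sq_sqrt hv2.le
  have hcos : Real.cos (2 * Real.arctan v) = 2 / (1 + v ^ 2) - 1 := by
    rw [Real.cos_two_mul, Real.cos_arctan, div_pow, one_pow, hs]
    ring
  have hsin : Real.sin (2 * Real.arctan v) = 2 * v / (1 + v ^ 2) := by
    rw [Real.sin_two_mul, Real.sin_arctan, Real.cos_arctan, mul_assoc, div_mul_div_comm, mul_one,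
      ← pow_two, hs]
    ring
  rw [Complex.exp_mul_I, ← Complex.ofReal_cos, ← Complex.ofReal_sin, hcos, hsin]
  have h1 : IsAlgebraic ℚ (1 + v ^ 2) := isAlgebraic_one.add (hv.pow 2)
  have h2 : IsAlgebraic ℚ (2 : ℝ) := by simpa using isAlgebraic_nat (R := ℚ) (A := ℝ) 2
  have hc : IsAlgebraic ℚ (2 / (1 + v ^ 2) - 1 : ℝ) := by
    rw [div_eq_mul_inv]; exact (h2.mul h1.inv).sub isAlgebraic_one
  have hs' : IsAlgebraic ℚ (2 * v / (1 + v ^ 2) : ℝ) := by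
    rw [div_eq_mul_inv]; exact (h2.mul hv).mul h1.inv
  exact (isAlgebraic_ofReal hc).add ((isAlgebraic_ofReal hs').mul isAlgebraic_I)

/-- Clearing denominators of a rational vector: `f_t = N_t · D ∈ ℤ` for the product `D > 0` of the denominators. -/
theorem exists_int_mul_of_rat {ι : Type} [Fintype ι] [DecidableEq ι] (N : ι → ℚ) :
    ∃ (D : ℕ) (f : ι → ℤ), 0 < D ∧ ∀ t, (f t : ℚ) = N t * D := by
  refine ⟨∏ t, (N t).den, fun t => (N t).num * ∏ t' ∈ Finset.univ.erase t, ((N t').den : ℤ),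
    Finset.prod_pos fun t _ => (N t).den_pos, fun t => ?_⟩
  rw [← Finset.mul_prod_erase Finset.univ (fun t' => (N t').den) (Finset.mem_univ t)]
  push_cast
  rw [← mul_assoc, Rat.mul_den_eq_num]

end G13
end Summit.KontsevichZagierPeriods.RootDecompRelativeModAbsolute.Rung30571.RegularisedLogLayer.CylLog.Leaf
end
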